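import Mathlib.Analysis.Fourier.PoissonSummation
import Mathlib.MeasureTheory.Measure.Haar.NormedSpace
import HarnessLib

/-!
# Connes–Consani 2021, Lemma 6.2 (= arXiv Lemma 35): the "delta function" identity
# `(2/L)∫_{−L}^{L} (½ + Σ_{n≥1} cos(2πnx/L)) f(x) dx = f(0)` by Poisson summation — PROVED

A. Connes, C. Consani, *Weil positivity and trace formula, the archimedean place*, Selecta Math.
(N.S.) 27 (2021), Paper No. 77 = arXiv:2006.13771 [bib: `ConnesConsani2021`]; §6.4, Lemma 6.2
(= Lemma 35 of the arXiv text, p. 24, display (deltafunction)), with its printed proof.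

**What is printed.**  "Lemma 6.2. Let `f ∈ C_c^∞(ℝ)_ev` be an even smooth function with support
contained in the closed interval `[−log 2, log 2]`.  Then, after rearranging the order of summation,
one obtains (deltafunction) `(2/log 2)∫_{−log 2}^{log 2} (½ + Σ_1^∞ cos(2πnx/log 2)) f(x) dx = f(0)`.
Proof.  The equality follows by applying Poisson's formula.  Let `L = ℤ log 2` be the lattice of
integral multiples of `log 2` and `L^⊥ = ℤ/log 2` be the dual lattice.  The Poisson summation formula
gives `Σ_L f(x) = (1/log 2) Σ_{L^⊥} f̂(y)`, `f̂(y) = ∫ f(u) exp(−2πiuy) du`.  Since `f` is even and its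
support is contained in the closed interval `[−log 2, log 2]` one has `Σ_L f(x) = f(0)`,
`f̂(y) = ∫_{−log 2}^{log 2} exp(2πiyx) f(x) dx = ∫_{−log 2}^{log 2} cos(2πyx) f(x) dx` and the Poisson
formula thus gives `f(0) = (1/log 2) Σ_{L^⊥} f̂(y) = (1/log 2) Σ_ℤ ∫_{−log 2}^{log 2} cos(2πnx/log 2) f(x) dx`
which gives (deltafunction)."

**What is PROVED here** (any `L > 0` in place of `log 2`; "after rearranging the order of summation"
is read, as in the printed proof, as the symmetric sum over `n ∈ ℤ`):
* `support_subset_Ioo`: a continuous `f` with `supp f ⊆ [−L, L]` vanishes off `(−L, L)` (so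
  `Σ_{x ∈ ℤL} f(x) = f(0)`);
* `apply_zero_eq_tsum_fourier`: for `f ∈ C_c^∞(ℝ)` with `supp f ⊆ [−L, L]`,
  `f(0) = L⁻¹ Σ_{n∈ℤ} f̂(n/L)`, `f̂(y) = ∫ f(u) e^{−2πiuy} du` — Poisson's formula
  (Mathlib `SchwartzMap.tsum_eq_tsum_fourier`, applied to `x ↦ f(Lx)`);
* `apply_zero_eq_tsum_integral_cos`: for EVEN such `f`, the last display of the printed proof,
  `f(0) = L⁻¹ Σ_{n∈ℤ} ∫_{−L}^{L} cos(2πnx/L) f(x) dx`.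

No RH claim; no named fact is introduced (cell `pub-rhdoor`, `HOME/lit/CC2021-RIGOUR-MAP.md` §1
item 7b: Lemma 6.2 organises the identity `Σ_n e_n = 1` behind (opT)).
-/

noncomputable section

open MeasureTheory Set Complex Filter Function
open scoped Real FourierTransform ContDiff

namespace Literature.NumberTheory.ConnesConsani2021

variable {f : ℝ → ℂ} {L : ℝ}

/-- "its support is contained in the closed interval `[−L, L]`" ⇒ `f` vanishes off the OPEN interval
(the support of a continuous function is open): `supp f ⊆ (−L, L)`.
[cite: ConnesConsani2021, Lemma 6.2 §6.4 p. 24 (proof)] -/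
theorem support_subset_Ioo (hf : Continuous f) (hsupp : tsupport f ⊆ Icc (-L) L) :
    support f ⊆ Ioo (-L) L := by
  rw [← interior_Icc]
  exact (isOpen_ne_fun hf continuous_const).subset_interior_iff.2 ((subset_tsupport f).trans hsupp)

/-- "`Σ_L f(x) = f(0)`": `f(Ln) = 0` for every integer `n ≠ 0`.
[cite: ConnesConsani2021, Lemma 6.2 §6.4 p. 24 (proof)] -/
theorem apply_mul_int_eq_zero (hf : Continuous f) (hsupp : tsupport f ⊆ Icc (-L) L) (hL : 0 < L)
    {n : ℤ} (hn : n ≠ 0) : f (L * n) = 0 := by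
  have h := support_subset_Ioo hf hsupp
  by_contra hne
  have hmem : L * (n : ℝ) ∈ Ioo (-L) L := h (mem_support.2 hne)
  rcases lt_or_gt_of_ne hn with hneg | hpos
  · have hn1 : (n : ℝ) ≤ -1 := by exact_mod_cast Int.le_sub_one_of_lt hneg
    have : L * (n : ℝ) ≤ -L := by nlinarith
    exact absurd hmem.1 (not_lt.2 this)
  · have hn1 : (1 : ℝ) ≤ n := by exact_mod_cast hpos
    have : L ≤ L * (n : ℝ) := by nlinarith
    exact absurd hmem.2 (not_lt.2 this)

/-- **Connes–Consani 2021, Lemma 6.2 — Poisson form** ("The Poisson summation formula gives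
`Σ_L f(x) = (1/L) Σ_{L^⊥} f̂(y)`, `f̂(y) = ∫ f(u) exp(−2πiuy) du` … `Σ_L f(x) = f(0)`", p. 24): for
`f ∈ C_c^∞(ℝ)` with `supp f ⊆ [−L, L]`, `L > 0`,
`f(0) = L⁻¹ Σ_{n∈ℤ} ∫ f(u) e^{−2πiu(n/L)} du`.  Proof as printed: Poisson summation (Mathlib, for the
Schwartz function `x ↦ f(Lx)`) at `x = 0`, the left side collapsing to `f(0)` by the support
condition. [cite: ConnesConsani2021, Lemma 6.2 §6.4 p. 24] -/
theorem apply_zero_eq_tsum_fourier (hf : ContDiff ℝ ∞ f) (hfc : HasCompactSupport f)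
    (hsupp : tsupport f ⊆ Icc (-L) L) (hL : 0 < L) :
    f 0 = (((L⁻¹ : ℝ)) : ℂ) *
      ∑' n : ℤ, ∫ u, Complex.exp (((-2 * π * u * (n / L) : ℝ) : ℂ) * I) * f u := by
  -- `g(x) = f(Lx)` is smooth with compact support, hence Schwartz
  set g : ℝ → ℂ := fun x ↦ f (L * x) with hg
  have hgc : HasCompactSupport g := hfc.comp_homeomorph (Homeomorph.mulLeft₀ L hL.ne')
  have hgd : ContDiff ℝ ∞ g := hf.comp (contDiff_const.mul contDiff_id)
  -- Poisson summation at `x = 0`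
  have hP : ∑' n : ℤ, g (0 + n) = ∑' n : ℤ, 𝓕 g n * fourier n ((0 : ℝ) : UnitAddCircle) :=
    SchwartzMap.tsum_eq_tsum_fourier (hgc.toSchwartzMap hgd) 0
  simp only [zero_add, QuotientAddGroup.mk_zero, fourier_eval_zero, mul_one] at hP
  -- left side: only `n = 0` survives
  have hleft : ∑' n : ℤ, g n = f 0 := by
    rw [tsum_eq_single 0 fun n hn ↦ ?_]
    · simp [hg]
    · exact apply_mul_int_eq_zero hf.continuous hsupp hL hn
  rw [← hleft, hP, ← tsum_mul_left]
  refine tsum_congr fun n ↦ ?_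
  -- right side: `𝓕 g (n) = L⁻¹ ∫ f(u) e^{−2πiu n/L} du` (substitution `u = Lx`)
  rw [Real.fourier_real_eq_integral_exp_smul]
  have hsub := Measure.integral_comp_mul_left
    (fun u : ℝ ↦ Complex.exp (((-2 * π * u * (n / L) : ℝ) : ℂ) * I) * f u) L
  rw [abs_of_pos (inv_pos.2 hL), Complex.real_smul] at hsub
  rw [← hsub]
  refine integral_congr_ae (Eventually.of_forall fun x ↦ ?_)
  simp only [hg, smul_eq_mul]
  congr 3
  field_simp

/-- `∫ e^{−2πiu n/L} f(u) du = ∫_{−L}^{L} cos(2πnu/L) f(u) du` for even `f` supported in `[−L, L]`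
("Since `f` is even and its support is contained in `[−L, L]` … `f̂(y) = ∫_{−L}^{L} cos(2πyx) f(x) dx`",
p. 24). [cite: ConnesConsani2021, Lemma 6.2 §6.4 p. 24 (proof)] -/
theorem integral_exp_mul_eq_setIntegral_cos (hf : Continuous f) (hfc : HasCompactSupport f)
    (hsupp : tsupport f ⊆ Icc (-L) L) (heven : ∀ x, f (-x) = f x) (n : ℤ) :
    ∫ u, Complex.exp (((-2 * π * u * (n / L) : ℝ) : ℂ) * I) * f u
      = ∫ u in Icc (-L) L, ((Real.cos (2 * π * n * u / L) : ℝ) : ℂ) * f u := by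
  -- Euler: `e^{−iθ} = cos θ − i sin θ`, `θ = 2πnu/L`
  have hexp : ∀ u : ℝ, Complex.exp (((-2 * π * u * (n / L) : ℝ) : ℂ) * I)
      = ((Real.cos (2 * π * n * u / L) : ℝ) : ℂ) - ((Real.sin (2 * π * n * u / L) : ℝ) : ℂ) * I := by
    intro u
    rw [show ((-2 * π * u * (n / L) : ℝ) : ℂ) * I = -(((2 * π * n * u / L : ℝ) : ℂ)) * I by
        push_cast; ring,
      Complex.exp_mul_I, Complex.cos_neg, Complex.sin_neg, ← Complex.ofReal_cos, ← Complex.ofReal_sin]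
    ring
  -- integrability of the two pieces (continuous with compact support)
  have hic : Integrable fun u ↦ ((Real.cos (2 * π * n * u / L) : ℝ) : ℂ) * f u :=
    ((Complex.continuous_ofReal.comp (Real.continuous_cos.comp
      ((continuous_const.mul continuous_id).div_const _))).mul hf).integrable_of_hasCompactSupport
      hfc.mul_left
  have his : Integrable fun u ↦ ((Real.sin (2 * π * n * u / L) : ℝ) : ℂ) * I * f u :=
    (((Complex.continuous_ofReal.comp (Real.continuous_sin.comp
      ((continuous_const.mul continuous_id).div_const _))).mul continuous_const).mul
      hf).integrable_of_hasCompactSupport hfc.mul_left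
  -- the odd part integrates to zero
  have hodd : ∫ u, ((Real.sin (2 * π * n * u / L) : ℝ) : ℂ) * I * f u = 0 := by
    have h := Measure.integral_comp_mul_left
      (fun u : ℝ ↦ ((Real.sin (2 * π * n * u / L) : ℝ) : ℂ) * I * f u) (-1)
    have e : ∀ u : ℝ, ((Real.sin (2 * π * n * (-1 * u) / L) : ℝ) : ℂ) * I * f (-1 * u)
        = -(((Real.sin (2 * π * n * u / L) : ℝ) : ℂ) * I * f u) := by
      intro u
      rw [neg_one_mul, heven, show 2 * π * n * -u / L = -(2 * π * n * u / L) by ring, Real.sin_neg]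
      push_cast
      ring
    simp only [e, integral_neg, inv_neg, inv_one, abs_neg, abs_one, one_smul] at h
    have h2 : (2 : ℂ) * ∫ u, ((Real.sin (2 * π * n * u / L) : ℝ) : ℂ) * I * f u = 0 := by
      linear_combination -h
    exact (mul_eq_zero.1 h2).resolve_left two_ne_zero
  have hsplit : ∫ u, Complex.exp (((-2 * π * u * (n / L) : ℝ) : ℂ) * I) * f u
      = (∫ u, ((Real.cos (2 * π * n * u / L) : ℝ) : ℂ) * f u)
        - ∫ u, ((Real.sin (2 * π * n * u / L) : ℝ) : ℂ) * I * f u := by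
    rw [← integral_sub hic his]
    refine integral_congr_ae (Eventually.of_forall fun u ↦ ?_)
    simp only [hexp, sub_mul]
  rw [hsplit, hodd, sub_zero]
  -- restrict to the support window
  refine (setIntegral_eq_integral_of_forall_compl_eq_zero fun u hu ↦ ?_).symm
  rw [image_eq_zero_of_notMem_tsupport fun h ↦ hu (hsupp h), mul_zero]

/-- **Connes–Consani 2021, Lemma 6.2 (= arXiv Lemma 35), display (deltafunction) in the form reached
by the printed proof**: for an even `f ∈ C_c^∞(ℝ)` with support in `[−L, L]` (`L = log 2` in the
source), `f(0) = L⁻¹ Σ_{n∈ℤ} ∫_{−L}^{L} cos(2πnx/L) f(x) dx` — i.e.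
`(2/L)∫_{−L}^{L}(½ + Σ_{n≥1} cos(2πnx/L)) f(x) dx = f(0)` "after rearranging the order of summation".
[cite: ConnesConsani2021, Lemma 6.2 §6.4 p. 24] -/
theorem apply_zero_eq_tsum_integral_cos (hf : ContDiff ℝ ∞ f) (hfc : HasCompactSupport f)
    (hsupp : tsupport f ⊆ Icc (-L) L) (hL : 0 < L) (heven : ∀ x, f (-x) = f x) :
    f 0 = (((L⁻¹ : ℝ)) : ℂ) *
      ∑' n : ℤ, ∫ x in Icc (-L) L, ((Real.cos (2 * π * n * x / L) : ℝ) : ℂ) * f x := by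
  rw [apply_zero_eq_tsum_fourier hf hfc hsupp hL]
  congr 1
  exact tsum_congr fun n ↦ integral_exp_mul_eq_setIntegral_cos hf.continuous hfc hsupp heven n

end Literature.NumberTheory.ConnesConsani2021

end
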